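import Mathlib.LinearAlgebra.Matrix.Determinant.Basic
import Mathlib.LinearAlgebra.FreeModule.PID
import Mathlib.LinearAlgebra.Dimension.Free
import Literature.NumberTheory.EllipticCurves.MordellWeil
import Literature.NumberTheory.EllipticCurves.Heights
import HarnessLib

-- provenance: harness21/H21/H21/Prelude/TranscendEllArithS/Regulator.lean @ 884d84e (interim HEAD d8f2665); M5 mechanical rewrite
/-!
# The elliptic regulator

Trunk `TranscendEllArithS` (G06), concept C14 (notion `regulator_elliptic`).

For a Weierstrass curve `W` over a field `K` carrying a family of admissible absolute values we
define, on the Mordell–Weil group `E(K) = W.toAffine.Point`: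

* `WeierstrassCurve.heightPairingMatrix P`, the Gram matrix `(⟨Pᵢ, Pⱼ⟩)ᵢⱼ` of a family of points
  `P : ι → E(K)` for the Néron–Tate height pairing
  `WeierstrassCurve.Affine.Point.heightPairing` (file `Heights`);
* `WeierstrassCurve.regulatorOf P = det (⟨Pᵢ, Pⱼ⟩)ᵢⱼ`, the regulator of a finite family;
* `WeierstrassCurve.regulator W = Reg(E/K)`, the regulator of representatives in `E(K)` of a
  chosen `ℤ`-basis of `E(K) / E(K)_tors`.

and state the standard facts over a number field: independence of the basis
(`regulatorOf_eq_regulator_of_isMordellWeilBasis`), `Reg = 1` in rank `0`, and `Reg > 0`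
(non-degeneracy of the Néron–Tate pairing on `E(K)/tors`; Silverman AEC VIII.9), as named facts
(`def … : Prop`). Each fact quantifies `[W.IsElliptic]` explicitly: a `Prop`-valued `def` whose
body does not use the instance would otherwise drop it and state the (false) claim for singular
Weierstrass curves as well (for `y² = x³` the group `E_ns(K) ≅ K` is not finitely generated and
`regulator` takes its junk value `0`).

## Mathlib search

Mathlib (pin v4.32.0) has no elliptic regulator, canonical height or height pairing (grep
`regulator`: only `NumberField.Units.regulator`, the Dirichlet regulator of a number field, which is
unrelated). We use Mathlib's `Matrix.det`, `Matrix.of`, `Module.finBasis`, `Module.Finite`,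
`Module.free_of_finite_type_torsion_free'`.

## Design choices

* **Namespace.** Declarations live in `namespace WeierstrassCurve` as a deliberate dot-notation
  extension of Mathlib's namespace (`W.regulator`), as fixed by the outline for the trunk.
* **Normalisation.** The pairing is `⟨P, Q⟩ = (ĥ(P+Q) - ĥ P - ĥ Q)/2` with `ĥ` in the Clay/Wiles
  normalisation (no factor `½`), so `⟨P, P⟩ = ĥ P` and `Reg` agrees with Silverman AEC VIII.9,
  Wiles' Clay text, Gross's conventions and the LMFDB.
* **`regulator`.** A `dite` on `Module.Finite ℤ E(K)` (true over number fields by Mordell–Weil,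
  `WeierstrassCurve.module_finite_point`). Under this hypothesis `E(K)/tors` is a finite
  torsion-free, hence free, `ℤ`-module and we take `Quotient.out` of the vectors of
  `Module.finBasis ℤ (E(K)/tors)`, indexed by `Fin (finrank ℤ (E(K)/tors))` (equal to
  `Fin W.mordellWeilRank` over a number field, `finrank_mordellWeilModTorsion_eq`; we avoid the
  cast). Junk value `0` when `E(K)` is not finitely generated. Independence of all choices is the
  named fact `regulatorOf_eq_regulator_of_isMordellWeilBasis`.
* **Sections.** `section Defs` works over any `[Height.AdmissibleAbsValues K]` (definitions and
  purely algebraic lemmas). `section NumberField` assumes `[NumberField K] [W.IsElliptic]` only and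
  uses Mathlib's instance `NumberField.instAdmissibleAbsValues` (outline §0: a number-field theorem
  is never stated under a generic admissible family).
* **Classical.** `noncomputable section`, `open scoped Classical`, no `[DecidableEq K]` variable,
  uniformly across the trunk.

## References

* [SilvermanAEC2009] J. H. Silverman, *The Arithmetic of Elliptic Curves*, GTM 106, 2nd ed.,
  VIII.9 (canonical height, Theorem VIII.9.3, the regulator, Proposition VIII.9.6) and C.16 (BSD).
* [Gross2011] B. H. Gross, *Lectures on the conjecture of Birch and Swinnerton-Dyer* (2011), §4.
* A. Wiles, *The Birch and Swinnerton-Dyer conjecture*, Clay Mathematics Institute (2000).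
-/

noncomputable section

open scoped Classical

namespace WeierstrassCurve

section Defs

variable {K : Type*} [Field K] [Height.AdmissibleAbsValues K] (W : WeierstrassCurve K)

variable {W} in
/-- The *height pairing matrix* (Néron–Tate Gram matrix) of a family of points `P : ι → E(K)`:
the matrix `(⟨Pᵢ, Pⱼ⟩)ᵢⱼ` of Néron–Tate height pairings. Silverman, AEC VIII.9 (the "elliptic
regulator" preceding Theorem VIII.9.3's corollaries); Wiles, Clay problem description. [folklore] -/
def heightPairingMatrix {ι : Type*} (P : ι → W.toAffine.Point) : Matrix ι ι ℝ :=
  Matrix.of fun i j => Affine.Point.heightPairing (P i) (P j)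

variable {W} in
/-- The *regulator* of a finite family of points `P : ι → E(K)`:
`Reg(P) = det (⟨Pᵢ, Pⱼ⟩)ᵢⱼ`, the determinant of the height pairing matrix (`= 1` for the empty
family). Silverman, AEC VIII.9; Wiles, Clay problem description. [folklore] -/
def regulatorOf {ι : Type*} [Fintype ι] [DecidableEq ι] (P : ι → W.toAffine.Point) : ℝ :=
  (heightPairingMatrix P).det

/-- The *elliptic regulator* `Reg(E/K)` of `W`: the regulator `det (⟨Pᵢ, Pⱼ⟩)` of representatives
`Pᵢ ∈ E(K)` of a chosen `ℤ`-basis of the free part `E(K) / E(K)_tors` (here `Module.finBasis` of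
the finite free `ℤ`-module `E(K)/tors`, lifted by `Quotient.out`). Junk value `0` if `E(K)` is not
a finite `ℤ`-module (never the case over a number field, `WeierstrassCurve.module_finite_point`).
Independent of the choices: `regulatorOf_eq_regulator_of_isMordellWeilBasis`.
Silverman, AEC VIII.9 and Conjecture C.16.5; Wiles, Clay problem description; Gross (2011) §4.
[cite: Gross2011, §4] -/
def regulator : ℝ :=
  if _h : Module.Finite ℤ W.toAffine.Point then
    haveI : Module.Finite ℤ (mordellWeilModTorsion W) :=
      Module.Finite.of_surjective
        ((QuotientAddGroup.mk' (AddCommGroup.torsion W.toAffine.Point)).toIntLinearMap)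
        (QuotientAddGroup.mk'_surjective (AddCommGroup.torsion W.toAffine.Point))
    regulatorOf fun i : Fin (Module.finrank ℤ (mordellWeilModTorsion W)) =>
      Quotient.out (Module.finBasis ℤ (mordellWeilModTorsion W) i)
  else 0

variable {W}

/-- The entries of the height pairing matrix (by definition). Silverman, AEC VIII.9. [folklore] -/
@[simp]
theorem heightPairingMatrix_apply {ι : Type*} (P : ι → W.toAffine.Point) (i j : ι) :
    heightPairingMatrix P i j = Affine.Point.heightPairing (P i) (P j) := rfl

/-- The height pairing matrix is symmetric (the Néron–Tate pairing is symmetric).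
Silverman, AEC Theorem VIII.9.3. [folklore] -/
theorem heightPairingMatrix_symm {ι : Type*} (P : ι → W.toAffine.Point) :
    (heightPairingMatrix P).IsSymm := by
  ext i j
  simp [heightPairingMatrix, Affine.Point.heightPairing_symm (P i) (P j)]

/-- The height pairing matrix of a reindexed family is the reindexed matrix (by definition;
Mathlib `Matrix.reindex`). Silverman, AEC VIII.9. [folklore] -/
theorem heightPairingMatrix_reindex {ι κ : Type*} (e : ι ≃ κ) (P : ι → W.toAffine.Point) :
    heightPairingMatrix (P ∘ e.symm) = Matrix.reindex e e (heightPairingMatrix P) := by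
  ext i j
  rfl

/-- The regulator of a family is invariant under reindexing (`det` is invariant under simultaneous
permutation of rows and columns, Mathlib `Matrix.det_reindex_self`). Silverman, AEC VIII.9.
[folklore] -/
theorem regulatorOf_reindex {ι κ : Type*} [Fintype ι] [DecidableEq ι] [Fintype κ] [DecidableEq κ]
    (e : ι ≃ κ) (P : ι → W.toAffine.Point) : regulatorOf (P ∘ e.symm) = regulatorOf P := by
  rw [regulatorOf, regulatorOf, heightPairingMatrix_reindex, Matrix.det_reindex_self]

/-- The regulator of the empty family is `1` (determinant of the empty matrix, Mathlib
`Matrix.det_isEmpty`); this is `Reg = 1` in rank `0`. Silverman, AEC C.16. [folklore] -/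
@[simp]
theorem regulatorOf_of_isEmpty {ι : Type*} [Fintype ι] [DecidableEq ι] [IsEmpty ι]
    (P : ι → W.toAffine.Point) : regulatorOf P = 1 :=
  Matrix.det_isEmpty

end Defs

section NumberField

variable {K : Type*} [Field K] [NumberField K] (W : WeierstrassCurve K)

variable {W} in
/-- The regulator does not depend on the Mordell–Weil basis: for any family `P : ι → E(K)` mapping
to a `ℤ`-basis of `E(K)/tors`, `det (⟨Pᵢ, Pⱼ⟩) = Reg(E/K)` (two bases differ by a matrix in
`GL_r(ℤ)`, of determinant `±1`, and the pairing factors through `E(K)/tors`).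
Silverman, AEC VIII.9 (remark after Theorem VIII.9.3); Gross (2011) §4. [cite: Gross2011, §4] -/
def regulatorOf_eq_regulator_of_isMordellWeilBasis : Prop :=
  ∀ [W.IsElliptic] {ι : Type*} [Fintype ι] [DecidableEq ι] {P : ι → W.toAffine.Point},
    IsMordellWeilBasis P → regulatorOf P = W.regulator

/-- In rank `0` the regulator of an elliptic curve over a number field is `1` (the empty
determinant; needs Mordell–Weil for `regulator` to leave its junk branch). Silverman, AEC VIII.9 /
C.16; Gross (2011) §4. [cite: Gross2011, §4] -/
def regulator_eq_one_of_mordellWeilRank_eq_zero : Prop :=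
  ∀ [W.IsElliptic], W.mordellWeilRank = 0 → W.regulator = 1

/-- The elliptic regulator of an elliptic curve over a number field is positive: the Néron–Tate
height extends to a positive definite quadratic form on `E(K) ⊗ ℝ`, so its Gram determinant on a
basis of the lattice `E(K)/tors` is `> 0` (Silverman, AEC Theorem VIII.9.3 with
Proposition VIII.9.6; Wiles, Clay problem description). [cite: SilvermanAEC2009, Prop. VIII.9.6] -/
def regulator_pos : Prop :=
  ∀ [W.IsElliptic], 0 < W.regulator

end NumberField

end WeierstrassCurve

end
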